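import Summits.ValiantsHypothesis.ValiantsHypothesis.Theses.FifoMatching
import Summits.ValiantsHypothesis.ValiantsHypothesis.Theorems.FifoMatchingGridCorCliqueFace
import Summits.ValiantsHypothesis.ValiantsHypothesis.Theorems.FifoMatchingGridCorShadowCompose
import HarnessLib

/-!
# R2: the rung `NNQuasiPolyLogDegreeCofactorHard` (stmt-ValiantsHypothesis-27271) holds

The route `ValiantsHypothesis/FifoMatching` item R2 `NNQuasiPolyLogDegreeCofactorHard` (filed by tenure g12, crit-3 FORM, the
val-idea-7 g7 rung of line `Cruxes/NNLinearDegreeCofactorHard/Lines/shadow_division.lean`): for every `k, c`, eventually in `n`,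
`NN_n · h` has monotone arithmetic-circuit complexity `> 2^((log₂ n + c)^c)` for EVERY nonzero cofactor `h ∈ ℝ≥0[x]` of
quasi-polynomial degree `deg h ≤ 2^((log₂ n + k)^k)` (`NN_n` = the nest-free (FIFO) matching polynomial, inlined in the route).
It sits strictly ABOVE the closed rungs 22993 / 23918 `NNLinearDegreeCofactorHard` and strictly BELOW the residual 21181
`NNDivisionHard` (the gap being the law-side cofactor-degree reduction N2 / N2♯, NOT claimed anywhere).

PROVED by composition of LANDED theorems, all BY NAME: `GridCorShadow.rung_of_27045` (val-port-2 g1, `…GridCorShadowCompose`)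
= A1 `GridCorShadow.queueGridZeroOnePoints_holds` (val-port-4, `…GridCorShadowZeroOnePoints`: the 0/1 points of the queue-grid
coordinate face of `NFP_n`, over qg1/c1's layout-B gadget rigidity) ∘ T2 `GridCorShadow.faceLift` (port-2 g1, HY21 Lemma 10 point form)
∘ T1 `GridCorShadow.ppShadow_of_grid` (port-2 g0) ∘ «G♭ ⇒ G» `GridCorShadow.gridCorShadowHard_of_cliqueFace` (port-2 g0: HY21 Prop 19
parabola shadow + one valid-inequality face lift) ∘ S `GridCorShadow.rung_of_shadow` (port-2 g1: HY21 Thm 42 for the tree's formula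
model + the quasi-polynomial formula balancing, NN instance), applied to the CLOSED item stmt-27045
`gridCorCliqueFace_holds : GridCorCliqueFace` (= `Literature.Combinatorics.Optimization.AboulkerEtAl2019_gridCorCliqueFace`, p10 g2 /
p9 g1: Aboulker–Fiorini–Huynh–Macchia–Seif 2019 Thm 6 IN PLACE on `COR(G_{t,t})`).  Line author: val-idea-7 g7; filed by the prover
seat val-port-4 g1 (val-lit desk g12 RULING #274 (1), D-0016).

Honest frame: a CRUX/support item of route FifoMatching on the monotone (`ℝ≥0`) side — «NN_n times any nonzero cofactor of
quasi-polynomial degree is quasi-polynomially hard for monotone circuits»; `NNNotVP`, 21181 `NNDivisionHard`, 26253 remain OPEN;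
VP ≠ VNP is NOT proved; nothing here is a summit statement.
-/

-- Sub = Summit single-conjunct layout: the duplicated namespace component is mandated by the tree.
set_option linter.dupNamespace false

namespace Summit.ValiantsHypothesis.ValiantsHypothesis.Theorems.FifoMatching

/-- **Item stmt-ValiantsHypothesis-27271 `NNQuasiPolyLogDegreeCofactorHard` — proved** (exact type of the route decl): the shadow /
face-lift / clique-face chain of line `shadow_division` applied to the closed item 27045 `gridCorCliqueFace_holds`.
[cite: HrubesYehudayoff2021, Thm. 42 with Lemma 10 and Prop. 19; AboulkerEtAl2019, Thm. 6] -/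
theorem nnQuasiPolyLogDegreeCofactorHard_holds :
    Summit.ValiantsHypothesis.ValiantsHypothesis.Theses.FifoMatching.NNQuasiPolyLogDegreeCofactorHard :=
  GridCorShadow.rung_of_27045 gridCorCliqueFace_holds

end Summit.ValiantsHypothesis.ValiantsHypothesis.Theorems.FifoMatching
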